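import Summits.MatrixMultiplication.MatrixMultiplication.Theses.CondensationDistance
import Literature.Computability.AlgebraicComplexity.StandardFamiliesProofs
import Literature.Computability.AlgebraicComplexity.DeterminantIrreducible

/-!
# Disproof of `CondensationSound` (stmt-MatrixMultiplication-15939) — findings

Crux (route `CondensationDistance`, rank 5, SOUNDNESS bridge): every VALID octahedral Plücker
derivation `f : Fin l → Finset (Fin (n + m'))` (each listed `n`-set `J = f i` has `p ≠ q ∈ J`,
`u ≠ v ∉ J` whose five octahedron mates `J−p+u, J−p+v, J−q+u, J−q+v, J−p−q+u+v` lie in the radius-1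
ball `{|J| = n, #(J ∩ [n, n+m')) ≤ 1}` or are listed EARLIER) that lists the target `[n, 2n)` yields
`Derivable ℂ (5 * l) (entries of the generic n × m' matrix Z) {det X}`, `X = Z[·, castLE]`.

## Verdict of cycle 1 (crux disprover `refuter-cdisprove-stmt-MatrixMultiplication-15939-0`, 2026-08-17)

**The crux resists: it is TRUE as typed** (classical; the registered line `Lines/birth.lean` /
`PICKED.md: Sketch` prove it).  Read-back of the three places where the typed statement could have
broken, all checked on the tree definitions (`DivisionSLP.lean`):
* budget `5` per octahedron is EXACT in the tree model: `DivStep` = `c • x + d • y` | `x * y` | `x⁻¹`,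
  so `P_J = (ε₁ P₁P₄ + ε₂ P₂P₃) · P₅⁻¹` is mul, mul, lin-comb, inv, mul = 5 steps, and ALL signs
  (of the three-term relation and of the ball values `P_{[n]−i+(n+j)} = ± Z_{ij}`) are absorbed by the
  free scalars `c, d` of the lin-comb step — no sign-fixing step is ever needed;
* the divisor `P_{J−p−q+u+v}` is a minor of a matrix of distinct indeterminates, nonzero in `ℂ(Z)`;
* the target `{n ≤ x < 2n}` enumerated increasingly is `Z`-columns `0..n-1` in order, so its
  coordinate is `+det X` on the nose (no final negation, no `5l+1`).
`Derivable` is monotone in the budget and counts "at most", constants are free (`P_{[n]} = 1`).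
Degenerate parameters: `n ≤ 1` or `l = 0` make the hypotheses unsatisfiable (a listed set has two
distinct elements; the target has `n` elements), `n = 2` forces nothing bad (`l = 1`, det X₂ in 3 ≤ 5
steps, `Cruxes/DerivationsBoundOmega/CruxAttack.lean: witness_two`).

## Findings, as theorems of this file

(a) LOAD-BEARING HYPOTHESES — every theorem of this file is sorry-free:
* `condensationSound_false_without_target` — drop "the target is listed": false at `n = 2, l = 0`
  (`det X₂` is neither an entry of `Z` nor a constant: evaluate at the all-ones and identity points).
* `condensationSound_false_without_validity` — drop the validity clause: false at `n = 33, l = 1`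
  by the DEGREE BOUND for division SLPs (`degRep_of_derivable`: after `s` Ω-steps every computed
  element is `p/q` with `deg p, deg q ≤ 2^s`; `deg det X₃₃ = 33 > 2⁵`).
* `condensationSound_false_without_order` — replace "listed EARLIER (`j < i`)" by "listed": false.
  The six vertices `{S ∪ e : e ⊂ {p,q,u,v}, |e| = 2}` of ONE octahedron certify each other
  (`octF_circular`), a circular "derivation" of length 6 of the target for every `n ≥ 2`; at
  `n = 2³⁰ + 1` the degree bound kills `Derivable ℂ 30`.  So any proof must use well-foundedness of
  the listing order (induction on `i`), not just closure of the listed family under the rule.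

(b) REDUNDANT CLAUSES (no theorem; information for provers): in the validity clause `p ≠ q`,
`u ≠ v` and the conjunct `J.card = n` of the ball alternative are implied by cardinality
bookkeeping along any derivation reaching the target (if `p = q` resp. `u = v` the fifth mate has
card `n + 1` resp. `n − 1` and is never known; mates of `n`-sets are `n`-sets) — a prover may but
need not use them.

(c) NATURAL STRENGTHENINGS:
* radius-2 ball (2 × 2 minors also free) — `condensationSound_false_radius_two` (sorry-free):
  FALSE at `n = m' = 3, l = 1`: the target `{3,4,5}` is one octahedron step above the radius-2 ball
  (`decide`), and `det X₃` is not derivable from the 9 entries in 5 steps by the FAN-IN BOUND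
  (`support_bound`: an element derivable in `s` steps from the indeterminates is `p/q` with `p, q`
  in at most `s + 1` variables — submodular counting invariant `|⋃_X V| ≤ |⋃_X anc| + |X|` along
  the sequence; `not_derivable_det_fanin`: `det Xₙ` needs `≥ n² − 1` steps since every entry occurs
  in it, tree `degreeOf_detPoly`).  So the crux's input set (entries) and ball (radius 1) match
  exactly; widening the ball requires widening the inputs.
* smaller budget `c * l`, `c < 5`: NOT refutable by degree or fan-in counting; `c = 2` fails only
  at `n = 2` (`L(det X₂) = 3 > 2`: would need an explicit 2-step case analysis); for `n ≥ 3` every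
  valid derivation has `l ≥ 5` (the target's five mates lie outside the radius-1 ball) and
  `3l ≥ L(det Xₙ)`.  The constant is immaterial to the route (`closes` only needs `O(l)`).
  Not attempted.
* larger lower bounds on `L(det Xₙ)` available here: `max(log₂ n, n² − 2) + 1` steps (degree and
  fan-in); nothing super-linear in `n²` — consistent with the crux being a pure upper-bound
  transfer.

(d) Targets: none (payload `stuck_stubs = []`; the four stubs of `Lines/birth.lean` were read and
are true as typed — `stub_simulation` even for an arbitrary coordinate system `P`).  Numeric
sanity check of `stub_exchange` with birth's `coord J = det Z[rowsOut J ↑, colsIn J ↑]`: for every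
configuration `(J, p, q, u, v)` with `(n, m') ∈ {(2,2),(2,3),(2,4),(3,3),(3,4),(4,4)}` (13 824
configurations) there are CONSTANT `ε₁, ε₂ ∈ {1, −1}` with
`coord J · coord J₅ = ε₁ coord J₁ coord J₄ + ε₂ coord J₂ coord J₃` on three random integer matrices
each — 0 failures (folder `compute/chk_exchange.py`, exact rational arithmetic, < 10 s); and
`coord [n,2n) = +det X` (rowsOut = all rows, colsIn = the first `n` columns, increasing).

Landed from this file (all ACCEPTED unless marked): `Theorems/CondensationSound/Negative/`
`WithoutTarget.lean` (p158918: (a1)), `DegreeBound.lean` (p159072: degree bound, (a2), (a3)),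
`FanInStep.lean` (p159639) + `FanInBound.lean` (p159921) (fan-in bound, (c)) — all ACCEPTED.
-/

set_option linter.dupNamespace false

noncomputable section

open scoped Classical
open MvPolynomial
open Literature.Computability.AlgebraicComplexity
open Summit.MatrixMultiplication.MatrixMultiplication.Theses.CondensationDistance

namespace Summit.MatrixMultiplication.MatrixMultiplication.Cruxes.CondensationSound.Disproof

/-! ## Notation: the objects of the crux -/

/-- `ℂ(Z)`, `Z` the generic `n × m'` matrix. -/
abbrev KK (n m' : ℕ) : Type := FractionRing (MvPolynomial (Fin n × Fin m') ℂ)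

/-- The input set of the crux: the entries of `Z` in `ℂ(Z)`. -/
def inputs (n m' : ℕ) : Set (KK n m') :=
  Set.range fun p : Fin n × Fin m' =>
    algebraMap (MvPolynomial (Fin n × Fin m') ℂ) (KK n m') (MvPolynomial.X p)

/-- The target element of the crux: `det X`, `X = Z[·, castLE h]`. -/
def detX (n m' : ℕ) (h : n ≤ m') : KK n m' :=
  algebraMap (MvPolynomial (Fin n × Fin m') ℂ) (KK n m')
    (Matrix.det (Matrix.of fun i j : Fin n => MvPolynomial.X (i, Fin.castLE h j)))

/-- The validity predicate of the route, verbatim. -/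
def Valid (n m' l : ℕ) (f : Fin l → Finset (Fin (n + m'))) : Prop :=
  ∀ i : Fin l, ∃ p ∈ f i, ∃ q ∈ f i, p ≠ q ∧ ∃ u ∉ f i, ∃ v ∉ f i, u ≠ v ∧
    ∀ J ∈ [insert u ((f i).erase p), insert v ((f i).erase p), insert u ((f i).erase q),
      insert v ((f i).erase q), insert u (insert v (((f i).erase p).erase q))],
      (J.card = n ∧ (J.filter fun x : Fin (n + m') => n ≤ x.val).card ≤ 1) ∨
        ∃ j : Fin l, j < i ∧ f j = J

/-- The validity predicate with "listed EARLIER" weakened to "listed" (mutation of (a3)). -/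
def ValidUnordered (n m' l : ℕ) (f : Fin l → Finset (Fin (n + m'))) : Prop :=
  ∀ i : Fin l, ∃ p ∈ f i, ∃ q ∈ f i, p ≠ q ∧ ∃ u ∉ f i, ∃ v ∉ f i, u ≠ v ∧
    ∀ J ∈ [insert u ((f i).erase p), insert v ((f i).erase p), insert u ((f i).erase q),
      insert v ((f i).erase q), insert u (insert v (((f i).erase p).erase q))],
      (J.card = n ∧ (J.filter fun x : Fin (n + m') => n ≤ x.val).card ≤ 1) ∨
        ∃ j : Fin l, f j = J

/-- The target `n`-set `[n, 2n)` of the route, verbatim. -/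
def target (n m' : ℕ) : Finset (Fin (n + m')) :=
  Finset.univ.filter fun x : Fin (n + m') => n ≤ x.val ∧ x.val < 2 * n

/-- READ-BACK: the crux is, by `Iff.rfl`, `∀ n m' h l f, Valid → target listed → Derivable (5l)`. -/
theorem condensationSound_iff :
    CondensationSound ↔ ∀ (n m' : ℕ) (h : n ≤ m') (l : ℕ) (f : Fin l → Finset (Fin (n + m'))),
      Valid n m' l f → (∃ i : Fin l, f i = target n m') →
        Derivable ℂ (5 * l) (inputs n m') {detX n m' h} :=
  Iff.rfl

/-! ## (a1) The target must be listed -/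

/-- `det X₂` is neither an entry of `Z` nor a constant of `ℂ(Z)`: at the all-ones point it
evaluates to `0` and every entry to `1`; at the identity point it evaluates to `1`, while a constant
takes the same value at both points. [folklore] -/
theorem detX_two_not_mem (m' : ℕ) (h : 2 ≤ m') :
    detX 2 m' h ∉ inputs 2 m' ∪ Set.range (algebraMap ℂ (KK 2 m')) := by
  have hinj := IsFractionRing.injective (MvPolynomial (Fin 2 × Fin m') ℂ) (KK 2 m')
  rintro (⟨p, hp⟩ | ⟨c, hc⟩)
  · have e := hinj hp
    have h1 := congrArg (MvPolynomial.eval fun _ : Fin 2 × Fin m' => (1 : ℂ)) e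
    rw [RingHom.map_det] at h1
    simp [Matrix.det_fin_two] at h1
  · unfold detX at hc
    rw [IsScalarTower.algebraMap_apply ℂ (MvPolynomial (Fin 2 × Fin m') ℂ) (KK 2 m'),
      MvPolynomial.algebraMap_eq] at hc
    have e := hinj hc
    have h1 := congrArg (MvPolynomial.eval fun _ : Fin 2 × Fin m' => (1 : ℂ)) e
    have h2 := congrArg
      (MvPolynomial.eval fun ij : Fin 2 × Fin m' => if ij.1.val = ij.2.val then (1 : ℂ) else 0) e
    rw [RingHom.map_det] at h1 h2
    simp [Matrix.det_fin_two] at h1 h2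
    rw [h1] at h2
    exact zero_ne_one h2

/-- **(a1) "The target is listed" is load-bearing.**  The crux with the hypothesis
`∃ i, f i = [n,2n)` deleted is FALSE: at `n = m' = 2`, `l = 0` the empty derivation is valid and
the conclusion `Derivable ℂ 0 (entries) {det X₂}` says that `det X₂` is an entry or a constant.
[folklore] -/
theorem condensationSound_false_without_target :
    ¬ ∀ (n m' : ℕ) (h : n ≤ m') (l : ℕ) (f : Fin l → Finset (Fin (n + m'))),
      Valid n m' l f → Derivable ℂ (5 * l) (inputs n m') {detX n m' h} := by
  intro H
  obtain ⟨l, -, hlen, hsub⟩ := H 2 2 le_rfl 0 (fun i => i.elim0) (fun i => i.elim0)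
  obtain rfl : l = [] := List.eq_nil_of_length_eq_zero (Nat.le_zero.mp hlen)
  have hmem := hsub (Set.mem_singleton (detX 2 2 le_rfl))
  simp only [List.not_mem_nil, Set.setOf_false, Set.union_empty] at hmem
  exact detX_two_not_mem 2 le_rfl hmem

/-! ## The degree bound for division straight-line programs (tree model `DivSeq`/`Derivable`)

`DegRep s x`: `x = p / q` in `ℂ(σ)` with `q ≠ 0` and `deg p, deg q ≤ 2^s`.  Inputs and constants
have `DegRep 0`; one `DivStep` raises `s` by one (`(p₁/q₁) ⋆ (p₂/q₂)` has numerator and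
denominator of degree `≤ 2^s + 2^s`); so everything computed by a sequence of length `s` from the
indeterminates has `DegRep s` — the trivial half of Strassen's degree bound (BCS 1997, Chap. 8). -/

section DegreeBound

variable {σ : Type*}

/-- `x = p/q`, `q ≠ 0`, `deg p, deg q ≤ 2^s`. -/
def DegRep (s : ℕ) (x : FractionRing (MvPolynomial σ ℂ)) : Prop :=
  ∃ p q : MvPolynomial σ ℂ, q ≠ 0 ∧
    algebraMap (MvPolynomial σ ℂ) (FractionRing (MvPolynomial σ ℂ)) q * x =
      algebraMap (MvPolynomial σ ℂ) (FractionRing (MvPolynomial σ ℂ)) p ∧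
    p.totalDegree ≤ 2 ^ s ∧ q.totalDegree ≤ 2 ^ s

theorem DegRep.mono {s t : ℕ} {x : FractionRing (MvPolynomial σ ℂ)} (h : DegRep s x)
    (hst : s ≤ t) : DegRep t x := by
  obtain ⟨p, q, hq, e, hp, hq'⟩ := h
  have : 2 ^ s ≤ 2 ^ t := Nat.pow_le_pow_right (by norm_num) hst
  exact ⟨p, q, hq, e, hp.trans this, hq'.trans this⟩

theorem degRep_X (v : σ) :
    DegRep 0 (algebraMap (MvPolynomial σ ℂ) (FractionRing (MvPolynomial σ ℂ)) (X v)) :=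
  ⟨X v, 1, one_ne_zero, by simp, by simp [totalDegree_X], by simp⟩

theorem degRep_const (c : ℂ) :
    DegRep (σ := σ) 0 (algebraMap ℂ (FractionRing (MvPolynomial σ ℂ)) c) :=
  ⟨C c, 1, one_ne_zero, by
    rw [IsScalarTower.algebraMap_apply ℂ (MvPolynomial σ ℂ) (FractionRing (MvPolynomial σ ℂ)),
      MvPolynomial.algebraMap_eq]; simp, by simp, by simp⟩

theorem degRep_of_mem_union {s : ℕ} {A : Set (FractionRing (MvPolynomial σ ℂ))}
    (hA : ∀ a ∈ A, DegRep s a) {x : FractionRing (MvPolynomial σ ℂ)}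
    (hx : x ∈ A ∪ Set.range (algebraMap ℂ (FractionRing (MvPolynomial σ ℂ)))) : DegRep s x := by
  rcases hx with hx | ⟨c, rfl⟩
  · exact hA x hx
  · exact (degRep_const c).mono (Nat.zero_le _)

/-- One Ω-step doubles the degree budget. [folklore] -/
theorem degRep_divStep {s : ℕ} {A : Set (FractionRing (MvPolynomial σ ℂ))}
    (hA : ∀ a ∈ A, DegRep s a) {v : FractionRing (MvPolynomial σ ℂ)} (hv : DivStep ℂ A v) :
    DegRep (s + 1) v := by
  obtain ⟨x, hx, y, hy, hxy⟩ := hv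
  obtain ⟨p₁, q₁, hq₁, e₁, dp₁, dq₁⟩ := degRep_of_mem_union hA hx
  obtain ⟨p₂, q₂, hq₂, e₂, dp₂, dq₂⟩ := degRep_of_mem_union hA hy
  set ιR := algebraMap (MvPolynomial σ ℂ) (FractionRing (MvPolynomial σ ℂ)) with hιR
  have h2 : 2 ^ (s + 1) = 2 ^ s + 2 ^ s := by ring
  have hmul : ∀ a b : MvPolynomial σ ℂ, a.totalDegree ≤ 2 ^ s → b.totalDegree ≤ 2 ^ s →
      (a * b).totalDegree ≤ 2 ^ (s + 1) := fun a b ha hb =>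
    (totalDegree_mul a b).trans (by omega)
  have hle : 2 ^ s ≤ 2 ^ (s + 1) := by omega
  rcases hxy with ⟨c, d, rfl⟩ | rfl | ⟨hx0, rfl⟩
  · -- linear combination `c • x + d • y = (C c p₁ q₂ + C d p₂ q₁) / (q₁ q₂)`
    refine ⟨C c * (p₁ * q₂) + C d * (p₂ * q₁), q₁ * q₂, mul_ne_zero hq₁ hq₂, ?_, ?_,
      hmul _ _ dq₁ dq₂⟩
    · rw [Algebra.smul_def, Algebra.smul_def,
        IsScalarTower.algebraMap_apply ℂ (MvPolynomial σ ℂ) (FractionRing (MvPolynomial σ ℂ)) c,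
        IsScalarTower.algebraMap_apply ℂ (MvPolynomial σ ℂ) (FractionRing (MvPolynomial σ ℂ)) d,
        MvPolynomial.algebraMap_eq]
      simp only [map_add, map_mul]
      linear_combination (ιR (C c) * ιR q₂) * e₁ + (ιR (C d) * ιR q₁) * e₂
    · refine (totalDegree_add _ _).trans (max_le ?_ ?_)
      · refine (totalDegree_mul _ _).trans ?_
        rw [totalDegree_C, zero_add]
        exact hmul _ _ dp₁ dq₂
      · refine (totalDegree_mul _ _).trans ?_
        rw [totalDegree_C, zero_add]
        exact hmul _ _ dp₂ dq₁
  · -- product `x y = (p₁ p₂) / (q₁ q₂)`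
    refine ⟨p₁ * p₂, q₁ * q₂, mul_ne_zero hq₁ hq₂, ?_, hmul _ _ dp₁ dp₂, hmul _ _ dq₁ dq₂⟩
    simp only [map_mul]
    linear_combination (ιR q₂ * y) * e₁ + (ιR p₁) * e₂
  · -- inverse `x⁻¹ = q₁ / p₁`
    have hp₁ : p₁ ≠ 0 := by
      rintro rfl
      rw [map_zero, mul_eq_zero] at e₁
      rcases e₁ with h0 | h0
      · exact hq₁ ((IsFractionRing.injective (MvPolynomial σ ℂ)
          (FractionRing (MvPolynomial σ ℂ))) (by rw [h0, map_zero]))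
      · exact hx0 h0
    refine ⟨q₁, p₁, hp₁, ?_, dq₁.trans hle, dp₁.trans hle⟩
    rw [← e₁, mul_assoc, mul_inv_cancel₀ hx0, mul_one]

/-- The degree budget along a computation sequence. [folklore] -/
theorem degRep_divSeq : ∀ (l : List (FractionRing (MvPolynomial σ ℂ)))
    (A : Set (FractionRing (MvPolynomial σ ℂ))) (s : ℕ),
    (∀ a ∈ A, DegRep s a) → DivSeq ℂ A l → ∀ x ∈ l, DegRep (s + l.length) x
  | [], _, _, _, _, x, hx => by simp at hx
  | v :: l, A, s, hA, hl, x, hx => by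
      rw [divSeq_cons] at hl
      have hv : DegRep (s + 1) v := degRep_divStep hA hl.1
      have hA' : ∀ a ∈ insert v A, DegRep (s + 1) a := by
        rintro a (rfl | ha)
        · exact hv
        · exact (hA a ha).mono (Nat.le_succ s)
      rcases List.mem_cons.mp hx with rfl | hx'
      · exact hv.mono (by simp)
      · exact (degRep_divSeq l (insert v A) (s + 1) hA' hl.2 x hx').mono
          (by simp only [List.length_cons]; omega)

/-- **Degree bound.** Everything derivable in `s` steps from a set of `DegRep 0` elements (e.g. the
indeterminates) has `DegRep s`. [folklore] -/
theorem degRep_of_derivable {s : ℕ} {A B : Set (FractionRing (MvPolynomial σ ℂ))}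
    (hA : ∀ a ∈ A, DegRep 0 a) (h : Derivable ℂ s A B) : ∀ b ∈ B, DegRep s b := by
  obtain ⟨l, hl, hlen, hsub⟩ := h
  intro b hb
  rcases hsub hb with hb' | hb'
  · exact (degRep_of_mem_union hA hb').mono (Nat.zero_le _)
  · exact (degRep_divSeq l A 0 hA hl b hb').mono (by omega)

end DegreeBound

/-- `det` of the generic `n × n` matrix (the crux's `X` at `m' = n`) has total degree `n`
(tree: `totalDegree_detPoly_holds`). -/
theorem totalDegree_detX (n : ℕ) :
    (Matrix.det (Matrix.of fun i j : Fin n =>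
      (MvPolynomial.X (i, Fin.castLE (le_refl n) j) : MvPolynomial (Fin n × Fin n) ℂ))).totalDegree
        = n := by
  have hM : (Matrix.of fun i j : Fin n =>
      (MvPolynomial.X (i, Fin.castLE (le_refl n) j) : MvPolynomial (Fin n × Fin n) ℂ)) =
      Matrix.mvPolynomialX (Fin n) (Fin n) ℂ := by
    ext i j : 1
    simp
  rw [hM]
  have h2 := @totalDegree_detPoly_holds (Fin n) _ _ ℂ
  unfold totalDegree_detPoly at h2
  have h3 : (detPoly (Fin n) ℂ).totalDegree = Fintype.card (Fin n) := h2
  rwa [Fintype.card_fin] at h3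

/-- **No division SLP of `s` steps computes `det Xₙ` from the entries when `2^s < n`.** [folklore] -/
theorem not_derivable_detX {n s : ℕ} (hn : 2 ^ s < n) :
    ¬ Derivable ℂ s (inputs n n) {detX n n le_rfl} := by
  intro hD
  have hA : ∀ a ∈ inputs n n, DegRep 0 a := by
    rintro a ⟨p, rfl⟩
    exact degRep_X p
  obtain ⟨p, q, hq, e, dp, -⟩ :=
    degRep_of_derivable hA hD (detX n n le_rfl) (Set.mem_singleton _)
  unfold detX at e
  rw [← map_mul] at e
  have e' := IsFractionRing.injective (MvPolynomial (Fin n × Fin n) ℂ) (KK n n) e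
  have hdet := totalDegree_detX n
  have hdet0 : Matrix.det (Matrix.of fun i j : Fin n =>
      (MvPolynomial.X (i, Fin.castLE (le_refl n) j) : MvPolynomial (Fin n × Fin n) ℂ)) ≠ 0 := by
    intro h0
    rw [h0, totalDegree_zero] at hdet
    omega
  have := congrArg MvPolynomial.totalDegree e'
  rw [totalDegree_mul_of_isDomain hq hdet0, hdet] at this
  omega

/-! ## (a2) Validity is load-bearing -/

/-- **(a2) The validity clause is load-bearing.**  With validity deleted, `l = 1`, `f 0 = [n,2n)`
would give `Derivable ℂ 5 (entries) {det Xₙ}` for every `n`; the degree bound refutes it at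
`n = 33 > 2⁵`. [folklore] -/
theorem condensationSound_false_without_validity :
    ¬ ∀ (n m' : ℕ) (h : n ≤ m') (l : ℕ) (f : Fin l → Finset (Fin (n + m'))),
      (∃ i : Fin l, f i = target n m') → Derivable ℂ (5 * l) (inputs n m') {detX n m' h} :=
  fun H => not_derivable_detX (n := 33) (s := 5) (by norm_num)
    (H 33 33 le_rfl 1 (fun _ => target 33 33) ⟨0, rfl⟩)

/-! ## (a3) The listing ORDER is load-bearing: one octahedron certifies itself -/

section Octahedron

variable {α : Type*} [DecidableEq α] (S : Finset α)

/-- The vertex `S ∪ {a, b}` of the octahedron over `S`. -/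
def octV (a b : α) : Finset α := insert a (insert b S)

theorem octV_comm (a b : α) : octV S a b = octV S b a := Finset.insert_comm a b S

/-- The six vertices of the octahedron over `S` spanned by `p, q, u, v`, target `S ∪ {p,q}` first. -/
def octF (p q u v : α) : Fin 6 → Finset α :=
  ![octV S p q, octV S q u, octV S q v, octV S p u, octV S p v, octV S u v]

/-- The exchange step at the vertex `S ∪ {a,b}` with `(p',q',u',v') = (a,b,c,d)`: its five mates are
the other five vertices `S ∪ {c,b}, S ∪ {d,b}, S ∪ {c,a}, S ∪ {d,a}, S ∪ {c,d}`. [folklore] -/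
theorem oct_step {a b c d : α} (hab : a ≠ b) (hac : a ≠ c) (had : a ≠ d) (hbc : b ≠ c)
    (hbd : b ≠ d) (ha : a ∉ S) (hb : b ∉ S) (hc : c ∉ S) (hd : d ∉ S) :
    a ∈ octV S a b ∧ b ∈ octV S a b ∧ c ∉ octV S a b ∧ d ∉ octV S a b ∧
    insert c ((octV S a b).erase a) = octV S c b ∧
    insert d ((octV S a b).erase a) = octV S d b ∧
    insert c ((octV S a b).erase b) = octV S c a ∧
    insert d ((octV S a b).erase b) = octV S d a ∧
    insert c (insert d (((octV S a b).erase a).erase b)) = octV S c d := by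
  have h1 : (octV S a b).erase a = insert b S :=
    Finset.erase_insert (by simp only [Finset.mem_insert]; rintro (h | h); exacts [hab h, ha h])
  have h2 : (octV S a b).erase b = insert a S := by
    rw [octV, Finset.erase_insert_of_ne hab, Finset.erase_insert hb]
  have h3 : ((octV S a b).erase a).erase b = S := by rw [h1, Finset.erase_insert hb]
  refine ⟨by simp [octV], by simp [octV], by simp [octV, hac.symm, hbc.symm, hc],
    by simp [octV, had.symm, hbd.symm, hd], ?_, ?_, ?_, ?_, ?_⟩
  · rw [h1]; rfl
  · rw [h1]; rfl
  · rw [h2]; rfl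
  · rw [h2]; rfl
  · rw [h3]; rfl

/-- Packaging of one step of the circular certificate for a listing `f : Fin 6 → _`. -/
theorem circular_step (P : Finset α → Prop) {f : Fin 6 → Finset α} {i : Fin 6} {a b c d : α}
    (hi : f i = octV S a b) (hab : a ≠ b) (hac : a ≠ c) (had : a ≠ d) (hbc : b ≠ c)
    (hbd : b ≠ d) (hcd : c ≠ d) (ha : a ∉ S) (hb : b ∉ S) (hc : c ∉ S) (hd : d ∉ S)
    (j₁ j₂ j₃ j₄ j₅ : Fin 6) (e₁ : f j₁ = octV S c b) (e₂ : f j₂ = octV S d b)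
    (e₃ : f j₃ = octV S c a) (e₄ : f j₄ = octV S d a) (e₅ : f j₅ = octV S c d) :
    ∃ p ∈ f i, ∃ q ∈ f i, p ≠ q ∧ ∃ u ∉ f i, ∃ v ∉ f i, u ≠ v ∧
      ∀ J ∈ [insert u ((f i).erase p), insert v ((f i).erase p), insert u ((f i).erase q),
        insert v ((f i).erase q), insert u (insert v (((f i).erase p).erase q))],
        P J ∨ ∃ j : Fin 6, f j = J := by
  obtain ⟨h₁, h₂, h₃, h₄, m₁, m₂, m₃, m₄, m₅⟩ := oct_step S hab hac had hbc hbd ha hb hc hd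
  rw [hi]
  refine ⟨a, h₁, b, h₂, hab, c, h₃, d, h₄, hcd, ?_⟩
  intro J hJ
  simp only [List.mem_cons, List.not_mem_nil, or_false] at hJ
  right
  rcases hJ with rfl | rfl | rfl | rfl | rfl
  · exact ⟨j₁, e₁.trans m₁.symm⟩
  · exact ⟨j₂, e₂.trans m₂.symm⟩
  · exact ⟨j₃, e₃.trans m₃.symm⟩
  · exact ⟨j₄, e₄.trans m₄.symm⟩
  · exact ⟨j₅, e₅.trans m₅.symm⟩

/-- **The circular certificate.**  For pairwise distinct `p, q, u, v ∉ S`, each of the six vertices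
of the octahedron is justified (in the sense of the route's rule, with "listed earlier" replaced by
"listed") by the other five. [folklore] -/
theorem octF_circular (P : Finset α → Prop) {p q u v : α} (hpq : p ≠ q) (hpu : p ≠ u)
    (hpv : p ≠ v) (hqu : q ≠ u) (hqv : q ≠ v) (huv : u ≠ v)
    (hp : p ∉ S) (hq : q ∉ S) (hu : u ∉ S) (hv : v ∉ S) :
    ∀ i : Fin 6, ∃ a ∈ octF S p q u v i, ∃ b ∈ octF S p q u v i, a ≠ b ∧
      ∃ c ∉ octF S p q u v i, ∃ d ∉ octF S p q u v i, c ≠ d ∧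
      ∀ J ∈ [insert c ((octF S p q u v i).erase a), insert d ((octF S p q u v i).erase a),
        insert c ((octF S p q u v i).erase b), insert d ((octF S p q u v i).erase b),
        insert c (insert d (((octF S p q u v i).erase a).erase b))],
        P J ∨ ∃ j : Fin 6, octF S p q u v j = J := by
  have f0 : octF S p q u v 0 = octV S p q := rfl
  have f1 : octF S p q u v 1 = octV S q u := rfl
  have f2 : octF S p q u v 2 = octV S q v := rfl
  have f3 : octF S p q u v 3 = octV S p u := rfl
  have f4 : octF S p q u v 4 = octV S p v := rfl
  have f5 : octF S p q u v 5 = octV S u v := rfl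
  have c1 : octF S p q u v 1 = octV S u q := f1.trans (octV_comm S q u)
  have c2 : octF S p q u v 2 = octV S v q := f2.trans (octV_comm S q v)
  have c3 : octF S p q u v 3 = octV S u p := f3.trans (octV_comm S p u)
  have c4 : octF S p q u v 4 = octV S v p := f4.trans (octV_comm S p v)
  have c5 : octF S p q u v 5 = octV S v u := f5.trans (octV_comm S u v)
  have c0 : octF S p q u v 0 = octV S q p := f0.trans (octV_comm S p q)
  intro i
  fin_cases i
  · -- vertex pq, step (p,q,u,v): mates uq vq up vp uv
    exact circular_step S P f0 hpq hpu hpv hqu hqv huv hp hq hu hv 1 2 3 4 5 c1 c2 c3 c4 f5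
  · -- vertex qu, step (q,u,p,v): mates pu vu pq vq pv
    exact circular_step S P f1 hqu hpq.symm hqv hpu.symm huv hpv hq hu hp hv 3 5 0 2 4 f3 c5 f0 c2 f4
  · -- vertex qv, step (q,v,p,u): mates pv uv pq uq pu
    exact circular_step S P f2 hqv hpq.symm hqu hpv.symm huv.symm hpu hq hv hp hu 4 5 0 1 3 f4 f5 f0
      c1 f3
  · -- vertex pu, step (p,u,q,v): mates qu vu qp vp qv
    exact circular_step S P f3 hpu hpq hpv hqu.symm huv hqv hp hu hq hv 1 5 0 4 2 f1 c5 c0 c4 f2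
  · -- vertex pv, step (p,v,q,u): mates qv uv qp up qu
    exact circular_step S P f4 hpv hpq hpu hqv.symm huv.symm hqu hp hv hq hu 2 5 0 3 1 f2 f5 c0
      c3 f1
  · -- vertex uv, step (u,v,p,q): mates pv qv pu qu pq
    exact circular_step S P f5 huv hpu.symm hqu.symm hpv.symm hqv.symm hpq hu hv hp hq 4 2 3 1 0
      f4 f2 f3 f1 f0

end Octahedron

/-- The circular "derivation" of the target in `J(2n, n)` (`m' = n`, `n ≥ 2`): the octahedron over
`S = [n+2, 2n)` spanned by `p = n, q = n+1, u = 0, v = 1`; its first vertex is the target. -/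
theorem circular_derivation (n : ℕ) (hn : 2 ≤ n) :
    ∃ f : Fin 6 → Finset (Fin (n + n)), ValidUnordered n n 6 f ∧ f 0 = target n n := by
  set T := target n n with hT
  set p : Fin (n + n) := ⟨n, by omega⟩
  set q : Fin (n + n) := ⟨n + 1, by omega⟩
  set u : Fin (n + n) := ⟨0, by omega⟩
  set v : Fin (n + n) := ⟨1, by omega⟩
  set S := (T.erase p).erase q with hS
  have hpT : p ∈ T := by simp [hT, target, p]; omega
  have hqT : q ∈ T.erase p := by
    simp [hT, target, q, p, Fin.ext_iff]; omega
  have huT : u ∉ T := by simp [hT, target, u]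
  have hvT : v ∉ T := by simp [hT, target, v]; omega
  have hp : p ∉ S := by simp [hS, p, q, Fin.ext_iff]
  have hq : q ∉ S := by simp [hS]
  have hu : u ∉ S := fun h => huT (Finset.mem_of_mem_erase (Finset.mem_of_mem_erase h))
  have hv : v ∉ S := fun h => hvT (Finset.mem_of_mem_erase (Finset.mem_of_mem_erase h))
  refine ⟨octF S p q u v, ?_, ?_⟩
  · intro i
    exact octF_circular S (fun J => J.card = n ∧ (J.filter fun x : Fin (n + n) => n ≤ x.val).card ≤ 1)
      (by simp [p, q, Fin.ext_iff]) (by simp [p, u, Fin.ext_iff]; omega)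
      (by simp [p, v, Fin.ext_iff]; omega) (by simp [q, u, Fin.ext_iff])
      (by simp [q, v, Fin.ext_iff]; omega) (by simp [u, v, Fin.ext_iff]) hp hq hu hv i
  · show octV S p q = T
    rw [octV, hS, Finset.insert_erase hqT, Finset.insert_erase hpT]

/-- **(a3) The listing order is load-bearing.**  With `j < i` deleted from "listed earlier", the six
vertices of one octahedron form a valid circular derivation of length 6 of the target for every
`n ≥ 2` (`circular_derivation`), so the mutated crux would give `Derivable ℂ 30 (entries) {det Xₙ}`
for all `n`; the degree bound refutes it at `n = 2³⁰ + 1`. [folklore] -/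
theorem condensationSound_false_without_order :
    ¬ ∀ (n m' : ℕ) (h : n ≤ m') (l : ℕ) (f : Fin l → Finset (Fin (n + m'))),
      ValidUnordered n m' l f → (∃ i : Fin l, f i = target n m') →
        Derivable ℂ (5 * l) (inputs n m') {detX n m' h} := by
  intro H
  obtain ⟨f, hf, hf0⟩ := circular_derivation (2 ^ 30 + 1) (by norm_num)
  exact not_derivable_detX (n := 2 ^ 30 + 1) (s := 30) (by norm_num)
    (H (2 ^ 30 + 1) (2 ^ 30 + 1) le_rfl 6 f hf ⟨0, hf0⟩)

/-! ## (c) Natural strengthening: the radius-2 ball is FALSE — the fan-in bound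

Operand-support ("fan-in") invariant for division SLPs: along a `DivSeq` we carry a support
assignment `V`, an ancestor assignment `anc ⊆ E` (`E` = entries so far) and the submodular count
`|⋃_X V| ≤ |⋃_X anc| + |X|`; so an element derivable in `s` steps from the indeterminates reads at
most `s + 1` of them (`support_bound`), `det Xₙ` needs `≥ n² − 1` steps (`not_derivable_det_fanin`),
and the radius-2 strengthening of the crux dies at `n = 3`, `l = 1` (`condensationSound_false_radius_two`).
Landed as `Theorems/CondensationSound/Negative/FanInStep.lean` + `FanInBound.lean`. -/

section FanIn

variable {σ : Type*}

/-- `x = p/q` with `p, q` free of every variable outside `W`. -/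
def SuppRep (W : Finset σ) (x : FractionRing (MvPolynomial σ ℂ)) : Prop :=
  ∃ p q : MvPolynomial σ ℂ, q ≠ 0 ∧
    algebraMap (MvPolynomial σ ℂ) (FractionRing (MvPolynomial σ ℂ)) q * x =
      algebraMap (MvPolynomial σ ℂ) (FractionRing (MvPolynomial σ ℂ)) p ∧
    ∀ w, w ∉ W → degreeOf w p = 0 ∧ degreeOf w q = 0

theorem SuppRep.mono {W W' : Finset σ} {x : FractionRing (MvPolynomial σ ℂ)} (h : SuppRep W x)
    (hW : W ⊆ W') : SuppRep W' x := by
  obtain ⟨p, q, hq, e, hz⟩ := h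
  exact ⟨p, q, hq, e, fun w hw => hz w fun h' => hw (hW h')⟩

theorem suppRep_X (v : σ) :
    SuppRep {v} (algebraMap (MvPolynomial σ ℂ) (FractionRing (MvPolynomial σ ℂ)) (X v)) := by
  refine ⟨X v, 1, one_ne_zero, by simp, fun w hw => ⟨?_, ?_⟩⟩
  · rw [degreeOf_X]
    simp only [Finset.mem_singleton] at hw
    simp [hw]
  · rw [← C_1, degreeOf_C]

theorem suppRep_const (W : Finset σ) (c : ℂ) :
    SuppRep W (algebraMap ℂ (FractionRing (MvPolynomial σ ℂ)) c) := by
  refine ⟨C c, 1, one_ne_zero, ?_, fun w _ => ⟨degreeOf_C _ _, by rw [← C_1, degreeOf_C]⟩⟩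
  rw [IsScalarTower.algebraMap_apply ℂ (MvPolynomial σ ℂ) (FractionRing (MvPolynomial σ ℂ)),
    MvPolynomial.algebraMap_eq]
  simp

/-- algebra of one step: operands supported on `W` give a result supported on `W`. -/
theorem suppRep_step {W : Finset σ} {x y v : FractionRing (MvPolynomial σ ℂ)}
    (hx : SuppRep W x) (hy : SuppRep W y)
    (hv : (∃ c d : ℂ, v = c • x + d • y) ∨ v = x * y ∨ (x ≠ 0 ∧ v = x⁻¹)) : SuppRep W v := by
  obtain ⟨p₁, q₁, hq₁, e₁, z₁⟩ := hx
  obtain ⟨p₂, q₂, hq₂, e₂, z₂⟩ := hy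
  set ιR := algebraMap (MvPolynomial σ ℂ) (FractionRing (MvPolynomial σ ℂ)) with hιR
  have zmul : ∀ (w : σ) (a b : MvPolynomial σ ℂ), degreeOf w a = 0 → degreeOf w b = 0 →
      degreeOf w (a * b) = 0 := fun w a b ha hb => by
    have := degreeOf_mul_le w a b; omega
  rcases hv with ⟨c, d, rfl⟩ | rfl | ⟨hx0, rfl⟩
  · refine ⟨C c * (p₁ * q₂) + C d * (p₂ * q₁), q₁ * q₂, mul_ne_zero hq₁ hq₂, ?_, fun w hw => ?_⟩
    · rw [Algebra.smul_def, Algebra.smul_def,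
        IsScalarTower.algebraMap_apply ℂ (MvPolynomial σ ℂ) (FractionRing (MvPolynomial σ ℂ)) c,
        IsScalarTower.algebraMap_apply ℂ (MvPolynomial σ ℂ) (FractionRing (MvPolynomial σ ℂ)) d,
        MvPolynomial.algebraMap_eq]
      simp only [map_add, map_mul]
      linear_combination (ιR (C c) * ιR q₂) * e₁ + (ιR (C d) * ιR q₁) * e₂
    · obtain ⟨a₁, b₁⟩ := z₁ w hw
      obtain ⟨a₂, b₂⟩ := z₂ w hw
      refine ⟨?_, zmul w _ _ b₁ b₂⟩
      have h1 := zmul w _ _ (degreeOf_C c w) (zmul w _ _ a₁ b₂)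
      have h2 := zmul w _ _ (degreeOf_C d w) (zmul w _ _ a₂ b₁)
      have := degreeOf_add_le w (C c * (p₁ * q₂)) (C d * (p₂ * q₁))
      rw [h1, h2] at this
      omega
  · refine ⟨p₁ * p₂, q₁ * q₂, mul_ne_zero hq₁ hq₂, ?_, fun w hw => ?_⟩
    · simp only [map_mul]
      linear_combination (ιR q₂ * y) * e₁ + (ιR p₁) * e₂
    · obtain ⟨a₁, b₁⟩ := z₁ w hw
      obtain ⟨a₂, b₂⟩ := z₂ w hw
      exact ⟨zmul w _ _ a₁ a₂, zmul w _ _ b₁ b₂⟩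
  · have hp₁ : p₁ ≠ 0 := by
      rintro rfl
      rw [map_zero, mul_eq_zero] at e₁
      rcases e₁ with h0 | h0
      · exact hq₁ ((IsFractionRing.injective (MvPolynomial σ ℂ)
          (FractionRing (MvPolynomial σ ℂ))) (by rw [h0, map_zero]))
      · exact hx0 h0
    refine ⟨q₁, p₁, hp₁, ?_, fun w hw => ⟨(z₁ w hw).2, (z₁ w hw).1⟩⟩
    rw [← e₁, mul_assoc, mul_inv_cancel₀ hx0, mul_one]

/-- The fan-in invariant on an available set `A'`: support assignment `V`, ancestor assignment
`anc ⊆ E ⊆ A'`, and the submodular count `|⋃_X V| ≤ |⋃_X anc| + |X|`. -/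
def Inv (A' : Set (FractionRing (MvPolynomial σ ℂ))) (E : Finset (FractionRing (MvPolynomial σ ℂ)))
    (V : FractionRing (MvPolynomial σ ℂ) → Finset σ)
    (anc : FractionRing (MvPolynomial σ ℂ) → Finset (FractionRing (MvPolynomial σ ℂ))) : Prop :=
  (∀ x ∈ A', SuppRep (V x) x) ∧ (∀ x ∈ A', anc x ⊆ E) ∧ (↑E ⊆ A') ∧
  ∀ X : Finset (FractionRing (MvPolynomial σ ℂ)), (↑X : Set _) ⊆ A' →
    (X.biUnion V).card ≤ (X.biUnion anc).card + X.card

/-- operand data: an operand `a ∈ A' ∪ consts` is covered by a set `Sa ⊆ A'` of size `≤ 1`. -/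
theorem operand_data {A' : Set (FractionRing (MvPolynomial σ ℂ))} {E V anc} (hI : Inv A' E V anc)
    {a : FractionRing (MvPolynomial σ ℂ)}
    (ha : a ∈ A' ∪ Set.range (algebraMap ℂ (FractionRing (MvPolynomial σ ℂ)))) :
    ∃ Sa : Finset (FractionRing (MvPolynomial σ ℂ)), (↑Sa : Set _) ⊆ A' ∧ Sa.card ≤ 1 ∧
      SuppRep (Sa.biUnion V) a := by
  rcases ha with ha | ⟨c, rfl⟩
  · refine ⟨{a}, by simpa using ha, by simp, ?_⟩
    rw [Finset.singleton_biUnion]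
    exact hI.1 a ha
  · exact ⟨∅, by simp, by simp, suppRep_const _ c⟩

/-- One step preserves the invariant, growing `E` by at most one. -/
theorem inv_step {A' : Set (FractionRing (MvPolynomial σ ℂ))} {E V anc} (hI : Inv A' E V anc)
    {v : FractionRing (MvPolynomial σ ℂ)} (hv : DivStep ℂ A' v) :
    ∃ E' V' anc', Inv (insert v A') E' V' anc' ∧ E'.card ≤ E.card + 1 := by
  by_cases hvA : v ∈ A'
  · refine ⟨E, V, anc, ?_, by omega⟩
    rwa [Set.insert_eq_of_mem hvA]
  obtain ⟨a, ha, b, hb, hab⟩ := hv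
  obtain ⟨Sa, hSaA, hSa1, ra⟩ := operand_data hI ha
  obtain ⟨Sb, hSbA, hSb1, rb⟩ := operand_data hI hb
  obtain ⟨hR, hAnc, hE, hCnt⟩ := hI
  -- new data
  set W := Sa.biUnion V ∪ Sb.biUnion V with hW
  set N := insert v (Sa.biUnion anc ∪ Sb.biUnion anc) with hN
  set V' := Function.update V v W with hV'
  set anc' := Function.update anc v N with hanc'
  have hv' : SuppRep W v :=
    suppRep_step (ra.mono Finset.subset_union_left) (rb.mono Finset.subset_union_right) hab
  refine ⟨insert v E, V', anc', ⟨?_, ?_, ?_, ?_⟩, by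
    calc (insert v E).card ≤ E.card + 1 := Finset.card_insert_le _ _⟩
  · rintro x (rfl | hx)
    · rw [hV', Function.update_self]
      exact hv'
    · have hxv : x ≠ v := fun h => hvA (h ▸ hx)
      rw [hV', Function.update_of_ne hxv]
      exact hR x hx
  · rintro x (rfl | hx)
    · simp only [hanc', Function.update_self, hN]
      refine Finset.insert_subset_insert _ (Finset.union_subset ?_ ?_)
      · exact Finset.biUnion_subset.2 fun y hy => hAnc y (hSaA hy)
      · exact Finset.biUnion_subset.2 fun y hy => hAnc y (hSbA hy)
    · have hxv : x ≠ v := fun h => hvA (h ▸ hx)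
      simp only [hanc', Function.update_of_ne hxv]
      exact (hAnc x hx).trans (Finset.subset_insert _ _)
  · intro y hy
    simp only [Finset.coe_insert, Set.mem_insert_iff] at hy
    rcases hy with rfl | hy
    · exact Set.mem_insert _ _
    · exact Set.mem_insert_of_mem _ (hE hy)
  · intro X hX
    by_cases hvX : v ∈ X
    swap
    · -- `v ∉ X`: nothing changed on `X`
      have hXA : (↑X : Set _) ⊆ A' := fun x hx => by
        rcases hX hx with h | h
        · exact absurd (h ▸ hx) hvX
        · exact h
      have e1 : X.biUnion V' = X.biUnion V :=
        Finset.biUnion_congr rfl fun x hx => by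
          have hxv : x ≠ v := by rintro rfl; exact hvX hx
          rw [hV', Function.update_of_ne hxv]
      have e2 : X.biUnion anc' = X.biUnion anc :=
        Finset.biUnion_congr rfl fun x hx => by
          have hxv : x ≠ v := by rintro rfl; exact hvX hx
          rw [hanc', Function.update_of_ne hxv]
      rw [e1, e2]
      exact hCnt X hXA
    -- `v ∈ X`: compare with `X' = (X.erase v) ∪ Sa ∪ Sb ⊆ A'`
    set X₀ := X.erase v with hX₀
    set X' := X₀ ∪ (Sa ∪ Sb) with hX'
    have hX₀A : (↑X₀ : Set _) ⊆ A' := fun x hx => by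
      have hx' := Finset.mem_coe.1 hx
      rw [hX₀, Finset.mem_erase] at hx'
      rcases hX hx'.2 with h | h
      · exact absurd h hx'.1
      · exact h
    have hX'A : (↑X' : Set _) ⊆ A' := by
      intro x hx
      have hx' := Finset.mem_coe.1 hx
      rw [hX', Finset.mem_union, Finset.mem_union] at hx'
      rcases hx' with h | h | h
      · exact hX₀A h
      · exact hSaA h
      · exact hSbA h
    -- (S1) supports
    have S1 : X.biUnion V' ⊆ X'.biUnion V := by
      intro y hy
      rw [Finset.mem_biUnion] at hy ⊢
      obtain ⟨x, hx, hyx⟩ := hy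
      by_cases hxv : x = v
      · subst hxv
        rw [hV', Function.update_self, hW, Finset.mem_union, Finset.mem_biUnion,
          Finset.mem_biUnion] at hyx
        rcases hyx with ⟨z, hz, hyz⟩ | ⟨z, hz, hyz⟩
        · exact ⟨z, by rw [hX']; simp [hz], hyz⟩
        · exact ⟨z, by rw [hX']; simp [hz], hyz⟩
      · rw [hV', Function.update_of_ne hxv] at hyx
        exact ⟨x, by rw [hX', hX₀]; simp [hxv, hx], hyx⟩
    -- (S2) ancestors
    have S3 : v ∉ X'.biUnion anc := by
      rw [Finset.mem_biUnion]
      rintro ⟨x, hx, hvx⟩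
      exact hvA (hE (hAnc x (hX'A hx) hvx))
    have S2 : insert v (X'.biUnion anc) ⊆ X.biUnion anc' := by
      intro y hy
      rw [Finset.mem_insert] at hy
      rw [Finset.mem_biUnion]
      rcases hy with rfl | hy
      · exact ⟨y, hvX, by rw [hanc', Function.update_self, hN]; exact Finset.mem_insert_self _ _⟩
      · rw [Finset.mem_biUnion] at hy
        obtain ⟨x, hx, hyx⟩ := hy
        rw [hX', Finset.mem_union, Finset.mem_union] at hx
        rcases hx with hx | hx | hx
        · have hxv : x ≠ v := (Finset.mem_erase.1 hx).1
          exact ⟨x, (Finset.mem_erase.1 hx).2, by rwa [hanc', Function.update_of_ne hxv]⟩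
        · refine ⟨v, hvX, ?_⟩
          rw [hanc', Function.update_self, hN, Finset.mem_insert, Finset.mem_union,
            Finset.mem_biUnion]
          exact Or.inr (Or.inl ⟨x, hx, hyx⟩)
        · refine ⟨v, hvX, ?_⟩
          rw [hanc', Function.update_self, hN, Finset.mem_insert, Finset.mem_union,
            Finset.mem_biUnion, Finset.mem_biUnion]
          exact Or.inr (Or.inr ⟨x, hx, hyx⟩)
    have c1 := Finset.card_le_card S1
    have c2 := Finset.card_le_card S2
    rw [Finset.card_insert_of_notMem S3] at c2
    have c3 := hCnt X' hX'A
    have c4 : X'.card ≤ X₀.card + 2 := by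
      calc X'.card ≤ X₀.card + (Sa ∪ Sb).card := Finset.card_union_le _ _
        _ ≤ X₀.card + (Sa.card + Sb.card) := by gcongr; exact Finset.card_union_le _ _
        _ ≤ X₀.card + 2 := by omega
    have c5 : X₀.card + 1 = X.card := Finset.card_erase_add_one hvX
    omega

/-- Along a computation sequence. -/
theorem inv_seq : ∀ (l : List (FractionRing (MvPolynomial σ ℂ)))
    (A' : Set (FractionRing (MvPolynomial σ ℂ))) (E V anc), Inv A' E V anc → DivSeq ℂ A' l →
    ∃ E' V' anc', Inv (A' ∪ {x | x ∈ l}) E' V' anc' ∧ E'.card ≤ E.card + l.length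
  | [], A', E, V, anc, hI, _ => ⟨E, V, anc, by simpa using hI, by simp⟩
  | v :: l, A', E, V, anc, hI, hl => by
      rw [divSeq_cons] at hl
      obtain ⟨E₁, V₁, anc₁, hI₁, hc₁⟩ := inv_step hI hl.1
      obtain ⟨E₂, V₂, anc₂, hI₂, hc₂⟩ := inv_seq l (insert v A') E₁ V₁ anc₁ hI₁ hl.2
      refine ⟨E₂, V₂, anc₂, ?_, by simp only [List.length_cons]; omega⟩
      have : insert v A' ∪ {x | x ∈ l} = A' ∪ {x | x ∈ v :: l} := by
        ext x; simp [or_comm, or_assoc, or_left_comm]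
      rwa [this] at hI₂

/-- **Fan-in bound.**  An element derivable in `s` steps from the indeterminates is `p/q` with
`p, q` involving at most `s + 1` variables. -/
theorem support_bound [Fintype σ] {s : ℕ} {t : FractionRing (MvPolynomial σ ℂ)}
    (h : Derivable ℂ s
      (Set.range fun v : σ => algebraMap (MvPolynomial σ ℂ) (FractionRing (MvPolynomial σ ℂ)) (X v))
      {t}) :
    ∃ W : Finset σ, W.card ≤ s + 1 ∧ SuppRep W t := by
  set A : Set (FractionRing (MvPolynomial σ ℂ)) :=
    Set.range fun v : σ => algebraMap (MvPolynomial σ ℂ) (FractionRing (MvPolynomial σ ℂ)) (X v)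
    with hA
  set ιR := algebraMap (MvPolynomial σ ℂ) (FractionRing (MvPolynomial σ ℂ)) with hιR
  -- base invariant on the inputs
  set V₀ : FractionRing (MvPolynomial σ ℂ) → Finset σ := fun x =>
    Finset.univ.filter fun v => ιR (X v) = x with hV₀
  have hinjX : ∀ u w : σ, ιR (X u) = ιR (X w) → u = w := fun u w h =>
    X_injective (IsFractionRing.injective (MvPolynomial σ ℂ) (FractionRing (MvPolynomial σ ℂ)) h)
  have hV₀X : ∀ u : σ, V₀ (ιR (X u)) = {u} := fun u => by
    ext w
    simp only [hV₀, Finset.mem_filter, Finset.mem_univ, true_and, Finset.mem_singleton]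
    exact ⟨fun h => hinjX _ _ h, fun h => by rw [h]⟩
  have hI₀ : Inv A ∅ V₀ (fun _ => ∅) := by
    refine ⟨?_, fun _ _ => Finset.Subset.refl _, by simp, ?_⟩
    · rintro x ⟨u, rfl⟩
      show SuppRep (V₀ (ιR (X u))) _
      rw [hV₀X]
      exact suppRep_X u
    · intro T hT
      have h1 : (T.biUnion V₀).card ≤ ∑ x ∈ T, (V₀ x).card := Finset.card_biUnion_le
      have h2 : ∀ x ∈ T, (V₀ x).card = 1 := by
        intro x hx
        obtain ⟨u, rfl⟩ := hT hx
        show (V₀ (ιR (X u))).card = 1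
        rw [hV₀X]; rfl
      rw [Finset.sum_congr rfl h2] at h1
      have h3 : (T.biUnion fun _ => (∅ : Finset (FractionRing (MvPolynomial σ ℂ)))) = ∅ := by
        ext y; simp
      rw [h3, Finset.card_empty, zero_add]
      simpa using h1
  obtain ⟨l, hl, hlen, hsub⟩ := h
  obtain ⟨E', V', anc', hI', hc'⟩ := inv_seq l A ∅ V₀ (fun _ => ∅) hI₀ hl
  have ht := hsub (Set.mem_singleton t)
  rcases ht with (ht | ⟨c, rfl⟩) | ht
  · -- an input
    obtain ⟨u, rfl⟩ := ht
    exact ⟨{u}, by simp, suppRep_X u⟩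
  · exact ⟨∅, by simp, suppRep_const ∅ c⟩
  · have htA : t ∈ A ∪ {x | x ∈ l} := Or.inr ht
    obtain ⟨hR, hAnc, hE, hCnt⟩ := hI'
    refine ⟨V' t, ?_, hR t htA⟩
    have := hCnt {t} (by simpa using htA)
    rw [Finset.singleton_biUnion, Finset.singleton_biUnion, Finset.card_singleton] at this
    have h2 : (anc' t).card ≤ E'.card := Finset.card_le_card (hAnc t htA)
    simp only [Finset.card_empty, zero_add] at hc'
    omega

/-- `det Xₙ` involves every variable with degree `1` (tree: `degreeOf_detPoly`). -/
theorem degreeOf_det_generic (n : ℕ) (w : Fin n × Fin n) :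
    degreeOf w (Matrix.det (Matrix.of fun i j : Fin n =>
      (MvPolynomial.X (i, Fin.castLE (le_refl n) j) : MvPolynomial (Fin n × Fin n) ℂ))) = 1 := by
  have hM : (Matrix.of fun i j : Fin n =>
      (MvPolynomial.X (i, Fin.castLE (le_refl n) j) : MvPolynomial (Fin n × Fin n) ℂ)) =
      Matrix.mvPolynomialX (Fin n) (Fin n) ℂ := by
    ext i j : 1
    simp
  rw [hM]
  exact degreeOf_detPoly ℂ w

/-- **No division SLP of `s` steps computes `det Xₙ` from the entries when `s + 2 ≤ n²`.** -/
theorem not_derivable_det_fanin {n s : ℕ} (hn : s + 2 ≤ n * n) :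
    ¬ Derivable ℂ s
      (Set.range fun p : Fin n × Fin n =>
        algebraMap (MvPolynomial (Fin n × Fin n) ℂ) (FractionRing (MvPolynomial (Fin n × Fin n) ℂ))
          (MvPolynomial.X p))
      {algebraMap (MvPolynomial (Fin n × Fin n) ℂ) (FractionRing (MvPolynomial (Fin n × Fin n) ℂ))
        (Matrix.det (Matrix.of fun i j : Fin n => MvPolynomial.X (i, Fin.castLE (le_refl n) j)))} := by
  intro hD
  obtain ⟨W, hW, p, q, hq, e, hz⟩ := support_bound hD
  have hcard : W.card < (Finset.univ : Finset (Fin n × Fin n)).card := by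
    rw [Finset.card_univ, Fintype.card_prod, Fintype.card_fin]; omega
  obtain ⟨w, -, hw⟩ := Finset.exists_mem_notMem_of_card_lt_card hcard
  obtain ⟨hp, hq0⟩ := hz w hw
  rw [← map_mul] at e
  have e' := IsFractionRing.injective (MvPolynomial (Fin n × Fin n) ℂ)
    (FractionRing (MvPolynomial (Fin n × Fin n) ℂ)) e
  have hdet := degreeOf_det_generic n w
  have hdet0 : Matrix.det (Matrix.of fun i j : Fin n =>
      (MvPolynomial.X (i, Fin.castLE (le_refl n) j) : MvPolynomial (Fin n × Fin n) ℂ)) ≠ 0 := by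
    intro h0
    rw [h0, degreeOf_zero] at hdet
    exact zero_ne_one hdet
  have := congrArg (degreeOf w) e'
  rw [degreeOf_mul_eq hq hdet0, hdet, hq0, hp] at this
  omega

/-- radius-2 strengthening is false at n = 3 -/
theorem condensationSound_false_radius_two :
    ¬ ∀ (n m' : ℕ) (h : n ≤ m') (l : ℕ) (f : Fin l → Finset (Fin (n + m'))),
      (∀ i : Fin l, ∃ p ∈ f i, ∃ q ∈ f i, p ≠ q ∧ ∃ u ∉ f i, ∃ v ∉ f i, u ≠ v ∧
        ∀ J ∈ [insert u ((f i).erase p), insert v ((f i).erase p), insert u ((f i).erase q),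
          insert v ((f i).erase q), insert u (insert v (((f i).erase p).erase q))],
          (J.card = n ∧ (J.filter fun x : Fin (n + m') => n ≤ x.val).card ≤ 2) ∨
            ∃ j : Fin l, j < i ∧ f j = J) →
      (∃ i : Fin l, f i = Finset.univ.filter fun x : Fin (n + m') => n ≤ x.val ∧ x.val < 2 * n) →
      Literature.Computability.AlgebraicComplexity.Derivable ℂ (5 * l)
        (Set.range fun p : Fin n × Fin m' =>
          algebraMap (MvPolynomial (Fin n × Fin m') ℂ) (FractionRing (MvPolynomial (Fin n × Fin m') ℂ))
            (MvPolynomial.X p))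
        {algebraMap (MvPolynomial (Fin n × Fin m') ℂ) (FractionRing (MvPolynomial (Fin n × Fin m') ℂ))
          (Matrix.det (Matrix.of fun i j : Fin n => MvPolynomial.X (i, Fin.castLE h j)))} := by
  intro H
  refine not_derivable_det_fanin (n := 3) (s := 5) (by norm_num) (H 3 3 le_rfl 1
    (fun _ => Finset.univ.filter fun x : Fin (3 + 3) => 3 ≤ x.val ∧ x.val < 2 * 3) ?_ ⟨0, rfl⟩)
  intro i
  obtain rfl : i = 0 := Subsingleton.elim _ _
  refine ⟨⟨3, by norm_num⟩, by decide, ⟨4, by norm_num⟩, by decide, by decide,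
    ⟨0, by norm_num⟩, by decide, ⟨1, by norm_num⟩, by decide, by decide, ?_⟩
  decide


end FanIn

end Summit.MatrixMultiplication.MatrixMultiplication.Cruxes.CondensationSound.Disproof

end
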